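import Literature.NumberTheory.Automorphic.VandermondeLatticeIndex   -- ★ p845514 O1∘O2 `index_range_units_map_adjoin_singleton_eq` (brings ★ O2 p845497, ★ `LatticeIndexGL` currency `𝒪[F]`, `𝓀[F]`, `valuation F`)
import Mathlib.Algebra.Algebra.Pi
import Mathlib.Algebra.Group.Submonoid.Units
import HarnessLib

/-!
# The unit index of the monogenic order `𝒪[γ]`, read in the unit group of `Fⁿ`: `[(𝒪^×)ⁿ : 𝒪[γ]^×] = (q−1)^{n−1} q^{S−(n−1)}` with `𝒪[γ]^× = (Algebra.adjoin 𝒪 {γ}).toSubmonoid.units`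
# — T3′ organ O8a-5E (token bridge O2 → O8a-1)  (Neukirch, *Algebraic Number Theory*, Ch. I §12; Rogawski (1990) §4.9 Lemma 4.9.3)

Topic `NumberTheory/Automorphic`; namespace `Literature.NumberTheory.Automorphic`.  THEOREMS ONLY (no definition, no instance, no notation, no named fact, no `sorry`); generic
`[Field F] [ValuativeRel F]` = (D0) currency (`𝒪 = 𝒪[F]`, `𝓀 = 𝓀[F]`, `q = Nat.card 𝓀[F]`, `hϖ : IsUniformizingElement ϖ`), any `n`.  Cell `pub/hodgecm-mathlib` (D-0151), crux H413 =
`stmt-HodgeConjecture-24833`; road «S3-tree» (LEAD F0P3a-plan (g11)), brick T3′ «DEPTH-ZERO κ-TRANSFER» (holder F0P3b-p01 (g11), DESIGN v2 §2 (P-1): `n₂ = [C : R^×]` = «O4 (c) ∘ O2 ∘ O3 ∘ O1»),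
organ **O8a-5E** (F0P3-p02 (g14), TAKING 16:55:44Z; A-p19 (g25) «=» 16:56:20Z and holds the F-half Σ2-F).  HONEST LABEL: HC_CM is proved only modulo the printed citations (2 remaining named
inputs hLiu418 24832, h413 24833) until rung 0 closes; this file is token bookkeeping between two ★ organs and asserts nothing printed.

THE MATHEMATICS.  O8a-1 (★ `SplitTorusOrderSelfDualTorsor`) counts the self-dual cyclic lattices of a deep regular `γ` as the relative index `R^×.relIndex C` inside the unit group
`(Fⁿ)ˣ` of the split étale algebra, with `R^× := (Algebra.adjoin 𝒪 {γ}).toSubmonoid.units` (`γ : Fin n → F`, `γ_i ∈ 𝒪`); O2 (★ `LocalOrderUnitIndex`, ★ `VandermondeLatticeIndex`) computes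
unit indices inside `(𝒪ⁿ)ˣ`, the order being `Algebra.adjoin 𝒪 {γ}` for `γ : Fin n → 𝒪` and its unit group the range of `Units.map (toSubring.subtype)`.  The coercion
`ι : 𝒪ⁿ → Fⁿ` is an injective `𝒪`-algebra map, so `Algebra.adjoin 𝒪 {↑γ} = ι(Algebra.adjoin 𝒪 {γ})` (Mathlib `AlgHom.map_adjoin`) and the pull-back of O8a-1's `R^×` along `Units.map ι`
IS O2's unit range; Mathlib `Subgroup.index_comap` (`(H.comap f).index = H.relIndex f.range`) then reads O1∘O2's number `[(𝒪^×)ⁿ : 𝒪[γ]^×] = (q−1)^{n−1} q^{S−(n−1)}` as the relative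
index of `R^×` in `(𝒪^×)ⁿ := (Units.map ι).range ≤ (Fⁿ)ˣ` — the E-side (`q_E = q_v²`) input of O4 (b)(c) ★ `Literature.RingTheory.GaloisAlgebras.relIndex_comap_eq_of_index_eq`; the F-side
(`R^σ ≤ 𝒪_Fⁿ`, ★ O3) is A-p19's Σ2-F.

* `mem_range_units_map_subtype_iff`, `mem_adjoin_coe_iff`, `ringHom_pi_subtype_comp_eval_eq_compLeft`, `comap_compLeft_adjoin_coe_toSubring_eq` (Σ2-F's `RE` = O2's order),
  `comap_units_map_units_adjoin_coe_eq` (the token bridge), **`relIndex_units_adjoin_range_unitsMap_eq`** (O8a-5E).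

## References
* [Neukirch1999] J. Neukirch, *Algebraic Number Theory*, Grundlehren 322 (1999): Ch. I §12 (orders, conductor, unit index `[𝒪_K^× : 𝒪^×]`).
* [SerreLocalFields1979] J.-P. Serre, *Local Fields*, GTM 67 (1979): Ch. III §6 (orders `A[x]` in separable algebras).
* [Hungerford1974] T. W. Hungerford, *Algebra*, GTM 73 (1974): Ch. III §1 (units of subrings), Ch. I Thm. 4.5.
* [Rogawski1990] J. D. Rogawski, *Automorphic Representations of Unitary Groups in Three Variables* (1990): §4.9 Lemma 4.9.3 p. 56 (where the count is consumed).
-/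

set_option autoImplicit false

noncomputable section

open scoped ValuativeRel
open Finset ValuativeRel

namespace Literature.NumberTheory.Automorphic

section Generic

variable {A : Type*} [CommRing A]

/-- `u ∈ (Units.map R.subtype).range ↔ ↑u ∈ R ∧ ↑u⁻¹ ∈ R`: the unit range of a subring is «units of the ambient ring lying in `R` together with their inverse»
(the token O2 ★ `LocalOrderUnitIndex` counts). [cite: Hungerford1974, Ch. III §1] -/
theorem mem_range_units_map_subtype_iff (R : Subring A) (u : Aˣ) :
    u ∈ (Units.map (R.subtype : R →* A)).range ↔ (u : A) ∈ R ∧ ((u⁻¹ : Aˣ) : A) ∈ R := by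
  constructor
  · rintro ⟨v, rfl⟩
    exact ⟨(v : R).2, by rw [← map_inv]; exact ((v⁻¹ : Rˣ) : R).2⟩
  · rintro ⟨h1, h2⟩
    exact ⟨⟨⟨u, h1⟩, ⟨(u⁻¹ : Aˣ), h2⟩, Subtype.ext u.mul_inv, Subtype.ext u.inv_mul⟩, Units.ext rfl⟩

end Generic

variable {F : Type*} [Field F] [ValuativeRel F] {n : ℕ}

/-- **The order does not see the ambient**: for `γ, x : Fin n → 𝒪`, `↑x ∈ Algebra.adjoin 𝒪 {↑γ}` (in `Fⁿ`, O8a-1's token) iff `x ∈ Algebra.adjoin 𝒪 {γ}` (in `𝒪ⁿ`, O1∕O2's token) —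
the coercion `𝒪ⁿ → Fⁿ` is an injective `𝒪`-algebra map and `adjoin` commutes with it (Mathlib `AlgHom.map_adjoin`). [cite: SerreLocalFields1979, Ch. III §6] -/
theorem mem_adjoin_coe_iff (γ x : Fin n → 𝒪[F]) :
    (fun i => (x i : F)) ∈ Algebra.adjoin 𝒪[F] ({fun i => (γ i : F)} : Set (Fin n → F)) ↔
      x ∈ Algebra.adjoin 𝒪[F] ({γ} : Set (Fin n → 𝒪[F])) := by
  set ιa : (Fin n → 𝒪[F]) →ₐ[𝒪[F]] (Fin n → F) := (Algebra.ofId 𝒪[F] F).compLeft (Fin n) with hιa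
  have hι : ∀ y : Fin n → 𝒪[F], ιa y = fun i => (y i : F) := fun y => rfl
  have hinj : Function.Injective ιa := by
    intro y z h
    funext i
    exact Subtype.ext (congrFun h i)
  rw [← hι x, ← hι γ, ← Set.image_singleton, ← AlgHom.map_adjoin, Subalgebra.mem_map]
  constructor
  · rintro ⟨y, hy, hyx⟩
    rwa [← hinj hyx]
  · exact fun h => ⟨x, h, rfl⟩


/-- The two spellings of the coercion `𝒪ⁿ → Fⁿ` agree: `RingHom.pi (fun i => 𝒪.subtype ∘ ev_i) = 𝒪.subtype.compLeft (Fin n)` (A-p19's Σ2-F `ιOn`∕`coeⁿ` vs this file's `ι`).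
[cite: Hungerford1974, Ch. III §1] -/
theorem ringHom_pi_subtype_comp_eval_eq_compLeft :
    (RingHom.pi fun i : Fin n => (𝒪[F]).subtype.comp (Pi.evalRingHom (fun _ : Fin n => 𝒪[F]) i)) = (𝒪[F]).subtype.compLeft (Fin n) :=
  RingHom.ext fun _ => rfl

/-- **The integral order as a pull-back**: `(Algebra.adjoin 𝒪 {↑γ}).toSubring.comap ι = (Algebra.adjoin 𝒪 {γ}).toSubring` — Σ2-F's `RE` IS O1∕O2's order.
[cite: SerreLocalFields1979, Ch. III §6] -/
theorem comap_compLeft_adjoin_coe_toSubring_eq (γ : Fin n → 𝒪[F]) :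
    (Algebra.adjoin 𝒪[F] ({fun i => (γ i : F)} : Set (Fin n → F))).toSubring.comap ((𝒪[F]).subtype.compLeft (Fin n)) =
      (Algebra.adjoin 𝒪[F] ({γ} : Set (Fin n → 𝒪[F]))).toSubring := by
  ext x
  rw [Subring.mem_comap, Subalgebra.mem_toSubring, Subalgebra.mem_toSubring]
  exact mem_adjoin_coe_iff γ x

/-- **Token bridge O8a-1 ↔ O2**: pulling O8a-1's unit group `(Algebra.adjoin 𝒪 {↑γ}).toSubmonoid.units ≤ (Fⁿ)ˣ` back along `Units.map ι`, `ι : 𝒪ⁿ → Fⁿ` the coercion, gives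
EXACTLY O2's unit range `(Units.map (Algebra.adjoin 𝒪 {γ}).toSubring.subtype).range ≤ (𝒪ⁿ)ˣ`. [cite: SerreLocalFields1979, Ch. III §6] -/
theorem comap_units_map_units_adjoin_coe_eq (γ : Fin n → 𝒪[F]) :
    ((Algebra.adjoin 𝒪[F] ({fun i => (γ i : F)} : Set (Fin n → F))).toSubmonoid.units).comap
        (Units.map (((𝒪[F]).subtype.compLeft (Fin n)) : (Fin n → 𝒪[F]) →* (Fin n → F))) =
      (Units.map ((Algebra.adjoin 𝒪[F] ({γ} : Set (Fin n → 𝒪[F]))).toSubring.subtype :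
        (Algebra.adjoin 𝒪[F] ({γ} : Set (Fin n → 𝒪[F]))).toSubring →* (Fin n → 𝒪[F]))).range := by
  ext u
  simp only [Subgroup.mem_comap, Submonoid.mem_units_iff, mem_range_units_map_subtype_iff, ← map_inv, Subalgebra.mem_toSubring,
    Units.coe_map, MonoidHom.coe_coe]
  exact Iff.and (mem_adjoin_coe_iff γ _) (mem_adjoin_coe_iff γ _)

variable {ϖ : F} (hϖ : IsUniformizingElement ϖ)
include hϖ

/-- **O8a-5E — THE E-SIDE UNIT INDEX IN O8a-1's TOKENS** (DESIGN v2 §2 (P-1) seam «O4 (c) ∘ O2 ∘ O3 ∘ O1», E-half; A-p19 (g25) «=», F-half = his Σ2-F):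
for a deep regular `γ : Fin n → 𝒪` (`v(γ_j − γ_i) = v(ϖ)^{N i j}`, `N i j ≥ 1`, `0 < n`), the relative index of `R^× := (Algebra.adjoin 𝒪 {↑γ}).toSubmonoid.units` in
`(𝒪^×)ⁿ := (Units.map ι).range ≤ (Fⁿ)ˣ` is **`(q − 1)^{n−1} · q^{S−(n−1)}`**, `S = Σ_{i<j} N i j`, `q = #𝓀` (Mathlib `Subgroup.index_comap` + the token bridge + ★ O1∘O2
`index_range_units_map_adjoin_singleton_eq`).  At `E_w` (`q_E = q_v²`) this is DESIGN v1 §1's `[𝒪_A^× : R₀^×] = (q²−1)^{n−1}q^{2(S−n+1)}`; with O4 (a)(b) and Σ2-F it yields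
`[C : R₀^×] = (q+1)^{n−1} q^{S−n+1}` = `n₂` of the parity literal. [cite: Neukirch1999, Ch. I §12] [cite: Rogawski1990, §4.9 Lemma 4.9.3 p. 56] -/
theorem relIndex_units_adjoin_range_unitsMap_eq [IsDiscreteValuationRing 𝒪[F]] [Finite 𝓀[F]]
    (hn : 0 < n) (γ : Fin n → 𝒪[F]) (N : Fin n → Fin n → ℕ) (hNpos : ∀ i j : Fin n, i < j → 0 < N i j)
    (hN : ∀ i j : Fin n, i < j → valuation F (((γ j : F) - γ i)) = valuation F ϖ ^ N i j) :
    ((Algebra.adjoin 𝒪[F] ({fun i => (γ i : F)} : Set (Fin n → F))).toSubmonoid.units).relIndex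
        (Units.map (((𝒪[F]).subtype.compLeft (Fin n)) : (Fin n → 𝒪[F]) →* (Fin n → F))).range =
      (Nat.card 𝓀[F] - 1) ^ (n - 1) * Nat.card 𝓀[F] ^ ((∑ i : Fin n, ∑ j ∈ Ioi i, N i j) - (n - 1)) := by
  rw [← Subgroup.index_comap, comap_units_map_units_adjoin_coe_eq, index_range_units_map_adjoin_singleton_eq hϖ hn γ N hNpos hN]

end Literature.NumberTheory.Automorphic

end
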